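import Literature.Analysis.FluidPDE.AxisymRadialQuotient
import Literature.Analysis.FluidPDE.CylindricalIntegration
import Literature.Analysis.FluidPDE.PoincareBall
import Mathlib.MeasureTheory.Integral.MeanInequalities
import HarnessLib

/-!
# `L²` bounds for the radial quotients: dilations and ray averages

Analysis/FluidPDE support file (one measurable equivalence with body + proved results; no named
facts) on the decomposition path of the named fact
`Literature.Analysis.FluidPDE.LeiZhang2017_smallSwirl_regularity` (Lei–Zhang 2017, Thm. 1.4).
The smooth quotients `radQuot S` (`S/r²`) and `radDerivQuot S = hadamardQuotFst (∂₀S)`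
(`(∂ᵣS)/r`) of `AxisymRadialQuotient.lean` are *ray averages*:
`hadamardQuotFst w x = ∫₀¹ ∂₀w(scaleFst τ x) dτ`, `radQuot S x = ∫₀¹ s · q(scaleH s x) ds`.
Their square integrability (needed to apply Lemma 2.1 of Lei–Zhang, `HouLeiLiEstimate.lean`, to
the solution at each time) follows from that of the integrands by Cauchy–Schwarz in the ray
parameter, Tonelli, and the scaling of Lebesgue measure under the two dilations:

* `fstSplit : ℝ³ ≃ᵐ ℝ × ℝ²`, `x ↦ (x₀, (x₁, x₂))` (volume preserving; the sibling of `cylSplit`);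
* `lintegral_comp_scaleFst` — `∫ G(scaleFst τ x) dx = |τ|⁻¹ ∫ G` (`τ ≠ 0`);
* `lintegral_comp_scaleH` — `∫ G(scaleH s x) dx = (s²)⁻¹ ∫ G` (`s ≠ 0`);
* `lintegral_sq_rayAverageFst_le` — `∫ (∫₀¹ h(scaleFst τ x) dτ)² dx ≤ 4 ∫ h²`
  (weight `τ^{-1/2}`: `(∫₀¹ h)² ≤ (∫₀¹ τ^{-1/2}) ∫₀¹ τ^{1/2} h²`, and
  `∫ h(scaleFst τ ·)² = τ⁻¹∫h²`);
* `lintegral_sq_rayAverageH_le` — `∫ (∫₀¹ s h(scaleH s x) ds)² dx ≤ ∫ h²`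
  (`(∫₀¹ s h)² ≤ ∫₀¹ s² h²` and `∫ h(scaleH s ·)² = s⁻² ∫ h²`);
* `lintegral_sq_hadamardQuotFst_le` — `∫ ‖hadamardQuotFst w‖² ≤ 4 ∫ ‖∂₀w‖²` for `w ∈ C¹`;
* `lintegral_sq_radQuot_le` — `∫ (radQuot S)² ≤ ∫ (radDerivQuot S)²` for `S ∈ C²`, hence
  `∫ (radQuot S)² ≤ 4 ∫ (∂₀∂₀S)²` (`lintegral_sq_radQuot_le_four_mul`).

All statements are folklore real analysis (Hardy-type bounds for averaging operators along rays;
cf. the tree's `lintegral_sq_rayAverage` in `SolenoidalTruncation.lean` for the full dilation).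

## Mathlib / tree search

Tree: `scaleFst`, `hadamardQuotFst` (`HadamardQuotient`), `scaleH`, `radQuot`, `radDerivQuot`
(`AxisymRadialQuotient`), `cylSplit`, `measurePreserving_cylSplit` (`CylindricalIntegration`),
`PoincareBall.lintegral_comp_smul_add` (dilations of Lebesgue measure on an inner product space).
Mathlib: `Real.map_volume_mul_left`, `lintegral_map_equiv`, `lintegral_prod_symm`,
`ENNReal.lintegral_mul_le_Lp_mul_Lq`, `enorm_integral_le_lintegral_enorm`, `integral_rpow`.

## References

* Z. Lei, Q. S. Zhang, Pacific J. Math. 289 (2017) = arXiv:1505.02628, §4 (the quantities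
  `Ω = ω^θ/r`, `v^r/r` in `L²`). [LeiZhang2017]
* E. M. Stein, *Singular Integrals and Differentiability Properties of Functions* (1970), App. A
  (Hardy's inequalities). [folklore]
-/

noncomputable section

open MeasureTheory Set Function Filter Topology WithLp
open scoped ENNReal NNReal

namespace Literature.Analysis.FluidPDE

/-! ### The splitting `ℝ³ ≃ ℝ × ℝ²` along the first coordinate -/

section FstSplit

/-- The measurable equivalence `ℝ³ ≃ᵐ ℝ × ℝ²`, `x ↦ (x₀, (x₁, x₂))`, through Mathlib's
`MeasurableEquiv.piFinSuccAbove` at the index `0` (the sibling of `cylSplit`, index `2`).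
[folklore] -/
def fstSplit : EuclideanSpace ℝ (Fin 3) ≃ᵐ ℝ × EuclideanSpace ℝ (Fin 2) :=
  ((MeasurableEquiv.toLp 2 (Fin 3 → ℝ)).symm.trans
    (MeasurableEquiv.piFinSuccAbove (fun _ => ℝ) 0)).trans
    (MeasurableEquiv.prodCongr (MeasurableEquiv.refl ℝ) (MeasurableEquiv.toLp 2 (Fin 2 → ℝ)))

/-- The first component of `fstSplit x` is `x₀`. [folklore] -/
@[simp] theorem fstSplit_apply_fst (x : EuclideanSpace ℝ (Fin 3)) : (fstSplit x).1 = x 0 := rfl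

/-- The second component of `fstSplit x` has coordinates `(x₁, x₂)`. [folklore] -/
@[simp] theorem fstSplit_apply_snd_apply (x : EuclideanSpace ℝ (Fin 3)) (j : Fin 2) :
    (fstSplit x).2 j = x (Fin.succAbove 0 j) := rfl

/-- The forward map on a vector written in coordinates. [folklore] -/
theorem fstSplit_toLp (a : ℝ) (w : EuclideanSpace ℝ (Fin 2)) :
    fstSplit (toLp 2 ![a, w 0, w 1]) = (a, w) := by
  refine Prod.ext rfl ?_
  ext j
  fin_cases j <;> rfl

/-- The inverse: `fstSplit.symm (a, w) = (a, w₀, w₁)`. [folklore] -/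
theorem fstSplit_symm_apply (a : ℝ) (w : EuclideanSpace ℝ (Fin 2)) :
    fstSplit.symm (a, w) = toLp 2 ![a, w 0, w 1] := by
  apply fstSplit.injective
  rw [MeasurableEquiv.apply_symm_apply, fstSplit_toLp]

/-- `fstSplit` preserves Lebesgue measure. [folklore] -/
theorem measurePreserving_fstSplit : MeasurePreserving fstSplit volume volume := by
  have h1 : MeasurePreserving (MeasurableEquiv.toLp 2 (Fin 3 → ℝ)).symm volume volume :=
    EuclideanSpace.volume_preserving_symm_measurableEquiv_toLp (Fin 3)
  have h2 : MeasurePreserving (MeasurableEquiv.piFinSuccAbove (fun _ : Fin 3 => ℝ) 0) volume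
      volume :=
    volume_preserving_piFinSuccAbove (fun _ => ℝ) 0
  have h3 : MeasurePreserving
      (MeasurableEquiv.prodCongr (MeasurableEquiv.refl ℝ) (MeasurableEquiv.toLp 2 (Fin 2 → ℝ)))
      volume volume :=
    (MeasurePreserving.id volume).prod (PiLp.volume_preserving_toLp (Fin 2))
  exact (h1.trans h2).trans h3

/-- `scaleFst τ` in the split variables scales the first factor: `scaleFst τ (a, w) = (τa, w)`.
[folklore] -/
theorem scaleFst_fstSplit_symm (τ a : ℝ) (w : EuclideanSpace ℝ (Fin 2)) :
    scaleFst τ (fstSplit.symm (a, w)) = fstSplit.symm (τ * a, w) := by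
  rw [fstSplit_symm_apply, fstSplit_symm_apply]
  ext i
  fin_cases i
  · simp [scaleFst]; ring
  · simp [scaleFst]
  · simp [scaleFst]

/-- `scaleH s` in the cylindrical variables scales the horizontal factor:
`scaleH s (z, w) = (z, s w)`. [folklore] -/
theorem scaleH_cylSplit_symm (s z : ℝ) (w : EuclideanSpace ℝ (Fin 2)) :
    scaleH s (cylSplit.symm (z, w)) = cylSplit.symm (z, s • w) := by
  rw [cylSplit_symm_apply, cylSplit_symm_apply]
  ext i
  fin_cases i <;> simp [scaleH, scaleFst] <;> ring

end FstSplit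

/-! ### Dilations -/

section Dilations

/-- Scaling of Lebesgue measure on the line, lower-integral form: `∫ g(τa) da = |τ|⁻¹ ∫ g`.
[folklore] -/
theorem lintegral_comp_mul_left_real (g : ℝ → ℝ≥0∞) {τ : ℝ} (hτ : τ ≠ 0) :
    ∫⁻ a, g (τ * a) = ENNReal.ofReal |τ⁻¹| * ∫⁻ a, g a := by
  calc ∫⁻ a, g (τ * a) = ∫⁻ a, g a ∂(Measure.map (τ * ·) volume) :=
        (lintegral_map_equiv g (Homeomorph.mulLeft₀ τ hτ).toMeasurableEquiv).symm
    _ = ENNReal.ofReal |τ⁻¹| * ∫⁻ a, g a := by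
        rw [Real.map_volume_mul_left hτ, lintegral_smul_measure, smul_eq_mul]

/-- **Dilation of the first coordinate**: `∫ G(scaleFst τ x) dx = |τ|⁻¹ ∫ G` for `τ ≠ 0` and
measurable `G`. [folklore] -/
theorem lintegral_comp_scaleFst {G : EuclideanSpace ℝ (Fin 3) → ℝ≥0∞} (hG : Measurable G)
    {τ : ℝ} (hτ : τ ≠ 0) :
    ∫⁻ x, G (scaleFst τ x) = ENNReal.ofReal |τ⁻¹| * ∫⁻ x, G x := by
  have hmp := measurePreserving_fstSplit.symm _
  have hGs : Measurable fun p : ℝ × EuclideanSpace ℝ (Fin 2) => G (fstSplit.symm p) :=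
    hG.comp fstSplit.symm.measurable
  -- transport to `ℝ × ℝ²`
  have hF : Measurable fun x => G (scaleFst τ x) :=
    hG.comp ((contDiff_scaleFst_uncurry (n := 0)).continuous.comp
      (continuous_id.prodMk continuous_const)).measurable
  have h1 : ∫⁻ x, G (scaleFst τ x) = ∫⁻ p : ℝ × EuclideanSpace ℝ (Fin 2),
      G (fstSplit.symm (τ * p.1, p.2)) := by
    calc ∫⁻ x, G (scaleFst τ x)
        = ∫⁻ p : ℝ × EuclideanSpace ℝ (Fin 2), (fun x => G (scaleFst τ x)) (fstSplit.symm p) :=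
          (hmp.lintegral_comp hF).symm
      _ = ∫⁻ p : ℝ × EuclideanSpace ℝ (Fin 2), G (fstSplit.symm (τ * p.1, p.2)) :=
          lintegral_congr fun p => by
            obtain ⟨a, w⟩ := p
            simp only [scaleFst_fstSplit_symm]
  have h2 : ∫⁻ x, G x = ∫⁻ p : ℝ × EuclideanSpace ℝ (Fin 2), G (fstSplit.symm p) :=
    (hmp.lintegral_comp hG).symm
  rw [h1, h2, Measure.volume_eq_prod, lintegral_prod_symm _ ?_,
    lintegral_prod_symm _ hGs.aemeasurable]
  · rw [← lintegral_const_mul _ ?_]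
    · refine lintegral_congr fun w => ?_
      exact lintegral_comp_mul_left_real (fun a => G (fstSplit.symm (a, w))) hτ
    · exact hGs.lintegral_prod_left
  · exact (hGs.comp ((measurable_fst.const_mul τ).prodMk measurable_snd)).aemeasurable

/-- **Dilation of the horizontal coordinates**: `∫ G(scaleH s x) dx = (s²)⁻¹ ∫ G` for `s ≠ 0` and
measurable `G`. [folklore] -/
theorem lintegral_comp_scaleH {G : EuclideanSpace ℝ (Fin 3) → ℝ≥0∞} (hG : Measurable G)
    {s : ℝ} (hs : s ≠ 0) :
    ∫⁻ x, G (scaleH s x) = ENNReal.ofReal |(s ^ 2)⁻¹| * ∫⁻ x, G x := by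
  have hmp := measurePreserving_cylSplit_symm
  have hGs : Measurable fun p : ℝ × EuclideanSpace ℝ (Fin 2) => G (cylSplit.symm p) :=
    hG.comp cylSplit.symm.measurable
  have hF : Measurable fun x => G (scaleH s x) :=
    hG.comp ((contDiff_scaleH_uncurry (n := 0)).continuous.comp
      (continuous_id.prodMk continuous_const)).measurable
  have h1 : ∫⁻ x, G (scaleH s x) = ∫⁻ p : ℝ × EuclideanSpace ℝ (Fin 2),
      G (cylSplit.symm (p.1, s • p.2)) := by
    calc ∫⁻ x, G (scaleH s x)
        = ∫⁻ p : ℝ × EuclideanSpace ℝ (Fin 2), (fun x => G (scaleH s x)) (cylSplit.symm p) :=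
          (hmp.lintegral_comp hF).symm
      _ = ∫⁻ p : ℝ × EuclideanSpace ℝ (Fin 2), G (cylSplit.symm (p.1, s • p.2)) :=
          lintegral_congr fun p => by
            obtain ⟨z, w⟩ := p
            simp only [scaleH_cylSplit_symm]
  have h2 : ∫⁻ x, G x = ∫⁻ p : ℝ × EuclideanSpace ℝ (Fin 2), G (cylSplit.symm p) :=
    (hmp.lintegral_comp hG).symm
  rw [h1, h2, Measure.volume_eq_prod, lintegral_prod _ ?_, lintegral_prod _ hGs.aemeasurable]
  · rw [← lintegral_const_mul _ hGs.lintegral_prod_right']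
    refine lintegral_congr fun z => ?_
    have h := PoincareBall.lintegral_comp_smul_add (E := EuclideanSpace ℝ (Fin 2))
      (fun w => G (cylSplit.symm (z, w))) hs 0
    simp only [add_zero, finrank_euclideanSpace, Fintype.card_fin] at h
    exact h
  · exact (hGs.comp (measurable_fst.prodMk (measurable_snd.const_smul s))).aemeasurable

end Dilations


/-! ### Ray averages: Cauchy–Schwarz, Tonelli, dilation -/

section RayAverage

/-- Cauchy–Schwarz for lower integrals, squared form: `(∫ f g)² ≤ (∫ f²)(∫ g²)`. [folklore] -/
theorem sq_lintegral_mul_le_of_aemeasurable {X : Type*} [MeasurableSpace X] {μ : Measure X}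
    {f g : X → ℝ≥0∞}
    (hf : AEMeasurable f μ) (hg : AEMeasurable g μ) :
    (∫⁻ x, f x * g x ∂μ) ^ 2 ≤ (∫⁻ x, f x ^ 2 ∂μ) * ∫⁻ x, g x ^ 2 ∂μ := by
  have h := ENNReal.lintegral_mul_le_Lp_mul_Lq μ Real.HolderConjugate.two_two hf hg
  have h2 : ∀ x : ℝ≥0∞, x ^ (2 : ℝ) = x ^ 2 := fun x => by
    rw [show (2 : ℝ) = ((2 : ℕ) : ℝ) by norm_num, ENNReal.rpow_natCast]
  calc (∫⁻ x, f x * g x ∂μ) ^ 2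
      ≤ ((∫⁻ x, f x ^ (2 : ℝ) ∂μ) ^ (1 / 2 : ℝ) * (∫⁻ x, g x ^ (2 : ℝ) ∂μ) ^ (1 / 2 : ℝ)) ^ 2 := by
        gcongr; simpa using h
    _ = (∫⁻ x, f x ^ 2 ∂μ) * ∫⁻ x, g x ^ 2 ∂μ := by
        rw [mul_pow, ← h2, ← h2, ← ENNReal.rpow_mul, ← ENNReal.rpow_mul]
        norm_num

/-- `∫₀¹ τ^{-1/2} dτ = 2` as a lower integral. [folklore] -/
theorem lintegral_Ioo_rpow_neg_half :
    ∫⁻ τ in Ioo (0 : ℝ) 1, ENNReal.ofReal (τ ^ (-(1 / 2) : ℝ)) = ENNReal.ofReal 2 := by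
  have hint : IntervalIntegrable (fun τ : ℝ => τ ^ (-(1 / 2) : ℝ)) volume 0 1 :=
    intervalIntegral.intervalIntegrable_rpow' (by norm_num)
  have hval : ∫ τ in (0 : ℝ)..1, τ ^ (-(1 / 2) : ℝ) = 2 := by
    rw [integral_rpow (Or.inl (by norm_num))]
    norm_num
  have hIoc : IntegrableOn (fun τ : ℝ => τ ^ (-(1 / 2) : ℝ)) (Ioc 0 1) := by
    simpa using hint.1
  have hIoo : IntegrableOn (fun τ : ℝ => τ ^ (-(1 / 2) : ℝ)) (Ioo 0 1) :=
    hIoc.mono_set Ioo_subset_Ioc_self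
  have hnn : 0 ≤ᵐ[volume.restrict (Ioo (0 : ℝ) 1)] fun τ : ℝ => τ ^ (-(1 / 2) : ℝ) :=
    (ae_restrict_iff' measurableSet_Ioo).2 (Eventually.of_forall fun τ hτ =>
      Real.rpow_nonneg hτ.1.le _)
  rw [← ofReal_integral_eq_lintegral_ofReal hIoo hnn]
  congr 1
  rw [← integral_Ioc_eq_integral_Ioo, ← intervalIntegral.integral_of_le zero_le_one, hval]

/-- `scaleFst τ x` is jointly measurable (it is jointly continuous). [folklore] -/
theorem measurable_scaleFst_uncurry :
    Measurable fun p : EuclideanSpace ℝ (Fin 3) × ℝ => scaleFst p.2 p.1 :=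
  (contDiff_scaleFst_uncurry (n := 0)).continuous.measurable

/-- `scaleH s x` is jointly measurable (it is jointly continuous). [folklore] -/
theorem measurable_scaleH_uncurry :
    Measurable fun p : EuclideanSpace ℝ (Fin 3) × ℝ => scaleH p.2 p.1 :=
  (contDiff_scaleH_uncurry (n := 0)).continuous.measurable

/-- **`L²` bound for the ray average along the first coordinate**:
`∫ (∫₀¹ h(scaleFst τ x) dτ)² dx ≤ 4 ∫ h²` for measurable `h ≥ 0` (Cauchy–Schwarz with the weight
`τ^{-1/2}`, Tonelli, and `∫ h(scaleFst τ ·)² = τ⁻¹ ∫ h²`). [folklore] -/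
theorem lintegral_sq_rayAverageFst_le {h : EuclideanSpace ℝ (Fin 3) → ℝ≥0∞} (hm : Measurable h) :
    ∫⁻ x, (∫⁻ τ in Ioo (0 : ℝ) 1, h (scaleFst τ x)) ^ 2 ≤ 4 * ∫⁻ x, h x ^ 2 := by
  -- measurability
  have hjoint : Measurable fun p : EuclideanSpace ℝ (Fin 3) × ℝ => h (scaleFst p.2 p.1) :=
    hm.comp measurable_scaleFst_uncurry
  have hw : Measurable fun p : EuclideanSpace ℝ (Fin 3) × ℝ =>
      ENNReal.ofReal (p.2 ^ (1 / 2 : ℝ)) * h (scaleFst p.2 p.1) ^ 2 :=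
    (ENNReal.measurable_ofReal.comp (measurable_snd.pow_const _)).mul (hjoint.pow_const _)
  have hslice : ∀ τ : ℝ, Measurable fun x : EuclideanSpace ℝ (Fin 3) => h (scaleFst τ x) :=
    fun τ => hm.comp ((contDiff_scaleFst_uncurry (n := 0)).continuous.comp
      (continuous_id.prodMk continuous_const)).measurable
  -- pointwise Cauchy–Schwarz in `τ`
  have hpt : ∀ x, (∫⁻ τ in Ioo (0 : ℝ) 1, h (scaleFst τ x)) ^ 2 ≤
      ENNReal.ofReal 2 * ∫⁻ τ in Ioo (0 : ℝ) 1,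
        ENNReal.ofReal (τ ^ (1 / 2 : ℝ)) * h (scaleFst τ x) ^ 2 := by
    intro x
    have heq : EqOn (fun τ : ℝ => h (scaleFst τ x))
        (fun τ : ℝ => ENNReal.ofReal (τ ^ (-(1 / 4) : ℝ)) *
          (ENNReal.ofReal (τ ^ (1 / 4 : ℝ)) * h (scaleFst τ x))) (Ioo 0 1) := by
      intro τ hτ
      simp only
      rw [← mul_assoc, ← ENNReal.ofReal_mul (Real.rpow_nonneg hτ.1.le _),
        ← Real.rpow_add hτ.1]
      norm_num
    have hf : AEMeasurable (fun τ : ℝ => ENNReal.ofReal (τ ^ (-(1 / 4) : ℝ)))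
        (volume.restrict (Ioo (0 : ℝ) 1)) :=
      (ENNReal.measurable_ofReal.comp (measurable_id.pow_const _)).aemeasurable
    have hgm : Measurable (fun τ : ℝ => ENNReal.ofReal (τ ^ (1 / 4 : ℝ)) * h (scaleFst τ x)) :=
      (ENNReal.measurable_ofReal.comp (measurable_id.pow_const _)).mul
        (hm.comp ((contDiff_scaleFst_uncurry (n := 0)).continuous.comp
          (continuous_const.prodMk continuous_id)).measurable)
    rw [setLIntegral_congr_fun measurableSet_Ioo heq]
    refine (sq_lintegral_mul_le_of_aemeasurable hf hgm.aemeasurable).trans (le_of_eq ?_)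
    have hf2 : ∫⁻ τ in Ioo (0 : ℝ) 1, ENNReal.ofReal (τ ^ (-(1 / 4) : ℝ)) ^ 2 =
        ENNReal.ofReal 2 := by
      rw [← lintegral_Ioo_rpow_neg_half]
      refine setLIntegral_congr_fun measurableSet_Ioo fun τ hτ => ?_
      rw [← ENNReal.ofReal_pow (Real.rpow_nonneg hτ.1.le _), ← Real.rpow_natCast,
        ← Real.rpow_mul hτ.1.le]
      norm_num
    have hg2 : ∫⁻ τ in Ioo (0 : ℝ) 1, (ENNReal.ofReal (τ ^ (1 / 4 : ℝ)) * h (scaleFst τ x)) ^ 2 =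
        ∫⁻ τ in Ioo (0 : ℝ) 1, ENNReal.ofReal (τ ^ (1 / 2 : ℝ)) * h (scaleFst τ x) ^ 2 := by
      refine setLIntegral_congr_fun measurableSet_Ioo fun τ hτ => ?_
      rw [mul_pow, ← ENNReal.ofReal_pow (Real.rpow_nonneg hτ.1.le _), ← Real.rpow_natCast,
        ← Real.rpow_mul hτ.1.le]
      norm_num
    rw [hf2, hg2]
  -- integrate in `x`, swap, dilate
  have hI : ∀ τ ∈ Ioo (0 : ℝ) 1, ∫⁻ x, ENNReal.ofReal (τ ^ (1 / 2 : ℝ)) * h (scaleFst τ x) ^ 2 =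
      ENNReal.ofReal (τ ^ (-(1 / 2) : ℝ)) * ∫⁻ x, h x ^ 2 := by
    intro τ hτ
    rw [lintegral_const_mul _ ((hslice τ).pow_const _),
      lintegral_comp_scaleFst (G := fun x => h x ^ 2) (hm.pow_const _) hτ.1.ne', ← mul_assoc,
      ← ENNReal.ofReal_mul (Real.rpow_nonneg hτ.1.le _), abs_of_pos (inv_pos.2 hτ.1),
      ← Real.rpow_neg_one, ← Real.rpow_add hτ.1]
    norm_num
  calc ∫⁻ x, (∫⁻ τ in Ioo (0 : ℝ) 1, h (scaleFst τ x)) ^ 2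
      ≤ ∫⁻ x, ENNReal.ofReal 2 * ∫⁻ τ in Ioo (0 : ℝ) 1,
          ENNReal.ofReal (τ ^ (1 / 2 : ℝ)) * h (scaleFst τ x) ^ 2 := lintegral_mono hpt
    _ = ENNReal.ofReal 2 * ∫⁻ τ in Ioo (0 : ℝ) 1, ∫⁻ x,
          ENNReal.ofReal (τ ^ (1 / 2 : ℝ)) * h (scaleFst τ x) ^ 2 := by
        rw [lintegral_const_mul _ (hw.lintegral_prod_right' (ν := volume.restrict (Ioo (0 : ℝ) 1))),
          lintegral_lintegral_swap (hw.aemeasurable)]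
    _ = ENNReal.ofReal 2 * ∫⁻ τ in Ioo (0 : ℝ) 1,
          ENNReal.ofReal (τ ^ (-(1 / 2) : ℝ)) * ∫⁻ x, h x ^ 2 := by
        rw [setLIntegral_congr_fun measurableSet_Ioo hI]
    _ = ENNReal.ofReal 2 * (ENNReal.ofReal 2 * ∫⁻ x, h x ^ 2) := by
        have hmeas : Measurable fun τ : ℝ => ENNReal.ofReal (τ ^ (-(1 / 2) : ℝ)) :=
          ENNReal.measurable_ofReal.comp (measurable_id.pow_const _)
        rw [lintegral_mul_const _ hmeas, lintegral_Ioo_rpow_neg_half]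
    _ = 4 * ∫⁻ x, h x ^ 2 := by
        rw [← mul_assoc, ← ENNReal.ofReal_mul (by norm_num : (0 : ℝ) ≤ 2)]
        norm_num

/-- **`L²` bound for the weighted horizontal ray average**:
`∫ (∫₀¹ s h(scaleH s x) ds)² dx ≤ ∫ h²` for measurable `h ≥ 0` (`(∫₀¹ s h)² ≤ ∫₀¹ s² h²` by
Cauchy–Schwarz on an interval of length one, Tonelli, and `∫ h(scaleH s ·)² = s⁻² ∫ h²`).
[folklore] -/
theorem lintegral_sq_rayAverageH_le {h : EuclideanSpace ℝ (Fin 3) → ℝ≥0∞} (hm : Measurable h) :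
    ∫⁻ x, (∫⁻ s in Ioo (0 : ℝ) 1, ENNReal.ofReal s * h (scaleH s x)) ^ 2 ≤ ∫⁻ x, h x ^ 2 := by
  have hjoint : Measurable fun p : EuclideanSpace ℝ (Fin 3) × ℝ => h (scaleH p.2 p.1) :=
    hm.comp measurable_scaleH_uncurry
  have hw : Measurable fun p : EuclideanSpace ℝ (Fin 3) × ℝ =>
      ENNReal.ofReal (p.2 ^ 2) * h (scaleH p.2 p.1) ^ 2 :=
    (ENNReal.measurable_ofReal.comp (measurable_snd.pow_const _)).mul (hjoint.pow_const _)
  have hslice : ∀ s : ℝ, Measurable fun x : EuclideanSpace ℝ (Fin 3) => h (scaleH s x) :=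
    fun s => hm.comp ((contDiff_scaleH_uncurry (n := 0)).continuous.comp
      (continuous_id.prodMk continuous_const)).measurable
  -- pointwise Cauchy–Schwarz in `s` against the constant `1`
  have hpt : ∀ x, (∫⁻ s in Ioo (0 : ℝ) 1, ENNReal.ofReal s * h (scaleH s x)) ^ 2 ≤
      ∫⁻ s in Ioo (0 : ℝ) 1, ENNReal.ofReal (s ^ 2) * h (scaleH s x) ^ 2 := by
    intro x
    have hgm : Measurable (fun s : ℝ => ENNReal.ofReal s * h (scaleH s x)) :=
      (ENNReal.measurable_ofReal.comp measurable_id).mul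
        (hm.comp ((contDiff_scaleH_uncurry (n := 0)).continuous.comp
          (continuous_const.prodMk continuous_id)).measurable)
    have h1 : (∫⁻ s in Ioo (0 : ℝ) 1, ENNReal.ofReal s * h (scaleH s x)) =
        ∫⁻ s in Ioo (0 : ℝ) 1, 1 * (ENNReal.ofReal s * h (scaleH s x)) := by simp only [one_mul]
    rw [h1]
    refine (sq_lintegral_mul_le_of_aemeasurable aemeasurable_const hgm.aemeasurable).trans
      (le_of_eq ?_)
    rw [one_pow, setLIntegral_const, Real.volume_Ioo, sub_zero, ENNReal.ofReal_one, one_mul,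
      one_mul]
    refine setLIntegral_congr_fun measurableSet_Ioo fun s hs => ?_
    rw [mul_pow, ENNReal.ofReal_pow hs.1.le]
  have hI : ∀ s ∈ Ioo (0 : ℝ) 1, ∫⁻ x, ENNReal.ofReal (s ^ 2) * h (scaleH s x) ^ 2 =
      ∫⁻ x, h x ^ 2 := by
    intro s hs
    rw [lintegral_const_mul _ ((hslice s).pow_const _),
      lintegral_comp_scaleH (G := fun x => h x ^ 2) (hm.pow_const _) hs.1.ne', ← mul_assoc,
      ← ENNReal.ofReal_mul (sq_nonneg _), abs_of_pos (inv_pos.2 (pow_pos hs.1 2)),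
      mul_inv_cancel₀ (pow_ne_zero 2 hs.1.ne'), ENNReal.ofReal_one, one_mul]
  calc ∫⁻ x, (∫⁻ s in Ioo (0 : ℝ) 1, ENNReal.ofReal s * h (scaleH s x)) ^ 2
      ≤ ∫⁻ x, ∫⁻ s in Ioo (0 : ℝ) 1, ENNReal.ofReal (s ^ 2) * h (scaleH s x) ^ 2 :=
        lintegral_mono hpt
    _ = ∫⁻ s in Ioo (0 : ℝ) 1, ∫⁻ x, ENNReal.ofReal (s ^ 2) * h (scaleH s x) ^ 2 :=
        lintegral_lintegral_swap (hw.aemeasurable)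
    _ = ∫⁻ s in Ioo (0 : ℝ) 1, ∫⁻ x, h x ^ 2 := setLIntegral_congr_fun measurableSet_Ioo hI
    _ = ∫⁻ x, h x ^ 2 := by
        rw [setLIntegral_const, Real.volume_Ioo, sub_zero, ENNReal.ofReal_one, mul_one]


/-! ### `L²` bounds for `hadamardQuotFst` and `radQuot` -/

variable {F : Type*} [NormedAddCommGroup F] [NormedSpace ℝ F]

/-- Pointwise: `‖hadamardQuotFst w x‖ ≤ ∫₀¹ ‖∂₀w(scaleFst τ x)‖ dτ` (as a lower integral).
[folklore] -/
theorem enorm_hadamardQuotFst_le (w : EuclideanSpace ℝ (Fin 3) → F) (x : EuclideanSpace ℝ (Fin 3)) :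
    ‖hadamardQuotFst w x‖ₑ ≤
      ∫⁻ τ in Ioo (0 : ℝ) 1, ‖fderiv ℝ w (scaleFst τ x) (EuclideanSpace.single 0 1)‖ₑ := by
  unfold hadamardQuotFst
  rw [intervalIntegral.integral_of_le zero_le_one, setLIntegral_congr Ioo_ae_eq_Ioc]
  exact enorm_integral_le_lintegral_enorm _

/-- **`∫ ‖hadamardQuotFst w‖² ≤ 4 ∫ ‖∂₀w‖²`** for `w ∈ C¹` (Hardy-type bound for the average
`∫₀¹ ∂₀w(τx₀, x₁, x₂) dτ`). [folklore] -/
theorem lintegral_sq_hadamardQuotFst_le {w : EuclideanSpace ℝ (Fin 3) → F} (hw : ContDiff ℝ 1 w) :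
    ∫⁻ x, ‖hadamardQuotFst w x‖ₑ ^ 2 ≤
      4 * ∫⁻ x, ‖fderiv ℝ w x (EuclideanSpace.single 0 1)‖ₑ ^ 2 := by
  have hc : Continuous fun y => fderiv ℝ w y (EuclideanSpace.single 0 1) :=
    (contDiff_fderiv_apply_const_succ (n := 0) (by exact_mod_cast hw) _).continuous
  have hm : Measurable fun y => ‖fderiv ℝ w y (EuclideanSpace.single 0 1)‖ₑ :=
    hc.enorm.measurable
  calc ∫⁻ x, ‖hadamardQuotFst w x‖ₑ ^ 2
      ≤ ∫⁻ x, (∫⁻ τ in Ioo (0 : ℝ) 1,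
          ‖fderiv ℝ w (scaleFst τ x) (EuclideanSpace.single 0 1)‖ₑ) ^ 2 :=
        lintegral_mono fun x => by gcongr; exact enorm_hadamardQuotFst_le w x
    _ ≤ 4 * ∫⁻ x, ‖fderiv ℝ w x (EuclideanSpace.single 0 1)‖ₑ ^ 2 :=
        lintegral_sq_rayAverageFst_le hm

variable {S : EuclideanSpace ℝ (Fin 3) → ℝ}

/-- Pointwise: `‖radQuot S x‖ ≤ ∫₀¹ s ‖radDerivQuot S (scaleH s x)‖ ds` (as a lower integral).
[folklore] -/
theorem enorm_radQuot_le (S : EuclideanSpace ℝ (Fin 3) → ℝ) (x : EuclideanSpace ℝ (Fin 3)) :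
    ‖radQuot S x‖ₑ ≤ ∫⁻ s in Ioo (0 : ℝ) 1, ENNReal.ofReal s * ‖radDerivQuot S (scaleH s x)‖ₑ := by
  unfold radQuot
  rw [intervalIntegral.integral_of_le zero_le_one]
  refine (enorm_integral_le_lintegral_enorm _).trans (le_of_eq ?_)
  rw [← setLIntegral_congr Ioo_ae_eq_Ioc]
  refine setLIntegral_congr_fun measurableSet_Ioo fun s hs => ?_
  rw [enorm_mul, Real.enorm_eq_ofReal hs.1.le]

/-- **`∫ (radQuot S)² ≤ ∫ (radDerivQuot S)²`** for `S ∈ C²`. [folklore] -/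
theorem lintegral_sq_radQuot_le (hS : ContDiff ℝ 2 S) :
    ∫⁻ x, ‖radQuot S x‖ₑ ^ 2 ≤ ∫⁻ x, ‖radDerivQuot S x‖ₑ ^ 2 := by
  have hm : Measurable fun y => ‖radDerivQuot S y‖ₑ := (continuous_radDerivQuot hS).enorm.measurable
  calc ∫⁻ x, ‖radQuot S x‖ₑ ^ 2
      ≤ ∫⁻ x, (∫⁻ s in Ioo (0 : ℝ) 1, ENNReal.ofReal s * ‖radDerivQuot S (scaleH s x)‖ₑ) ^ 2 :=
        lintegral_mono fun x => by gcongr; exact enorm_radQuot_le S x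
    _ ≤ ∫⁻ x, ‖radDerivQuot S x‖ₑ ^ 2 := lintegral_sq_rayAverageH_le hm

/-- **`∫ (radDerivQuot S)² ≤ 4 ∫ (∂₀∂₀S)²`** for `S ∈ C²`
(`radDerivQuot S = hadamardQuotFst (∂₀S)`). [folklore] -/
theorem lintegral_sq_radDerivQuot_le (hS : ContDiff ℝ 2 S) :
    ∫⁻ x, ‖radDerivQuot S x‖ₑ ^ 2 ≤
      4 * ∫⁻ x, ‖fderiv ℝ (fun y => fderiv ℝ S y (EuclideanSpace.single 0 1)) x
        (EuclideanSpace.single 0 1)‖ₑ ^ 2 :=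
  lintegral_sq_hadamardQuotFst_le
    (contDiff_fderiv_apply_const_succ (n := 1) (by exact_mod_cast hS) _)

/-- **`∫ (radQuot S)² ≤ 4 ∫ (∂₀∂₀S)²`** for `S ∈ C²`: the `L²` norm of `S/r²` is controlled by that
of one second derivative of `S` (a codimension-two trace bound: near the axis `S/r²` is
`½∂₀∂₀S` on the axis). [folklore] -/
theorem lintegral_sq_radQuot_le_four_mul (hS : ContDiff ℝ 2 S) :
    ∫⁻ x, ‖radQuot S x‖ₑ ^ 2 ≤
      4 * ∫⁻ x, ‖fderiv ℝ (fun y => fderiv ℝ S y (EuclideanSpace.single 0 1)) x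
        (EuclideanSpace.single 0 1)‖ₑ ^ 2 :=
  (lintegral_sq_radQuot_le hS).trans (lintegral_sq_radDerivQuot_le hS)

/-- `MemLp` form: if `S ∈ C²` and `∂₀∂₀S ∈ L²` then `radDerivQuot S ∈ L²` and `radQuot S ∈ L²`.
[folklore] -/
theorem memLp_radDerivQuot_of_memLp (hS : ContDiff ℝ 2 S)
    (h2 : MemLp (fun x => fderiv ℝ (fun y => fderiv ℝ S y (EuclideanSpace.single 0 1)) x
      (EuclideanSpace.single 0 1)) 2 volume) :
    MemLp (radDerivQuot S) 2 volume ∧ MemLp (radQuot S) 2 volume := by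
  have hfin : ∫⁻ x, ‖fderiv ℝ (fun y => fderiv ℝ S y (EuclideanSpace.single 0 1)) x
      (EuclideanSpace.single 0 1)‖ₑ ^ 2 < ⊤ := by
    have h := h2.integrable_sq.hasFiniteIntegral
    simpa [HasFiniteIntegral, enorm_pow] using h
  have key : ∀ {f : EuclideanSpace ℝ (Fin 3) → ℝ}, Continuous f → ∫⁻ x, ‖f x‖ₑ ^ 2 < ⊤ →
      MemLp f 2 volume := by
    intro f hf hlt
    refine (memLp_two_iff_integrable_sq hf.aestronglyMeasurable).2
      ⟨(hf.pow 2).aestronglyMeasurable, ?_⟩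
    simpa [HasFiniteIntegral, enorm_pow] using hlt
  have h4 : (4 : ℝ≥0∞) * ∫⁻ x, ‖fderiv ℝ (fun y => fderiv ℝ S y (EuclideanSpace.single 0 1)) x
      (EuclideanSpace.single 0 1)‖ₑ ^ 2 < ⊤ := ENNReal.mul_lt_top (by simp) hfin
  exact ⟨key (continuous_radDerivQuot hS) ((lintegral_sq_radDerivQuot_le hS).trans_lt h4),
    key (continuous_radQuot hS) ((lintegral_sq_radQuot_le_four_mul hS).trans_lt h4)⟩

end RayAverage

end Literature.Analysis.FluidPDE

end
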